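import Summits.AtomisticToContinuum.Crystallization.Theorems.FrustratedLawDichotomyCellMetric

/-!
# FrustratedLawDichotomy · crux `AperiodicFrustratedLawGap` (stmt-AtomisticToContinuum-27623) — CELL-SOUND VI: ADMISSIBILITY OF A METRIC-BOX CELL
(cell decomp-a2c, lens-5 g113; continues `…CellMetric`; crit r1766 (C) «what class A still owes (ii): the admissibility facts per cell family»)

A class-A row is the family of placements `pos_F m = posL F (a m)` of ONE label template `a : ι → Fin 3 → ℝ` (`a o = 0`) over a parameter
set `B` of cell matrices whose METRIC `FᵀF` lies in an entrywise box `Glo ≤ FᵀF ≤ Ghi`.  The four admissibility clauses of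
`…CellFrame.rowFloor_of_cells` (root at `0`, `2τ`-separation, `τ`-balls inside the window `Rc`, interior labels `7/20` inside) then follow,
UNIFORMLY over the box, from finitely many RATIONAL corner inequalities on the label data — the two-corner sums `gramLo`, `gramHi` of
`…CellMetric.gram_mem_box` — which a K-file decides by `norm_num`:
1. `gramLo`, `gramHi`; `gramLo_le`, `le_gramHi`; `lt_norm_posL`, `le_norm_posL'`; `sep_of_gramLo`, `norm_add_le_of_gramHi`, `inset_of_gramHi`
   (the four admissibility clauses), `le_dist_of_gramLo`, `le_norm_of_gramLo`, `norm_le_of_gramHi` (the list side conditions and norm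
   windows of `…CellTailsRem.lb_le_certFloorL_trunc`) and `norm_sq_mem_of_box`, `dist_sq_mem_of_box` (the sqrt-free `t = r²` windows fed to
   (229) `shellMin_le_phiT`, (238) `psiT_mem` / `secondNeg_le`), all uniformly over the box.
2. ★ `rowFloor_of_gramBox` — `rowFloor_of_cells` with the admissibility clauses replaced by corner inequalities: the class-A ROW FLOOR
   from (corner facts) + (`hcert : ∀ F ∈ B, 2(cUp + mc) ≤ certFloorL …`); `B` is any subset of the metric box (take it countable — e.g.
   rational cell matrices — so that the row is measurable by `…CellHalo.measurableSet_row`, the `hK` clause of (228)).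

House conventions: SI units · italic scalars, bold vectors, sans-serif tensors · numbered formulae only when referenced · en-dash for
ranges · References = cited works, numbered, alphabetical · no footnotes; Remarks at section ends · British spelling, -ise · Lennard-Jones
hyphenated; NASH capitalised as the Statement's notion · "folklore" tags standard bookkeeping; no new references are cited in this file.
-/

noncomputable section

namespace Summit.AtomisticToContinuum.Crystallization.Theorems.FrustratedLawDichotomyCellAdmissible

open MeasureTheory Metric Set RealInnerProductSpace
open scoped BigOperators
open Literature.MathematicalPhysics.StatisticalMechanics (lennardJones rootEnergy)
open Literature.Probability.Process (IsRootedHardCore)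
open Summit.AtomisticToContinuum.Crystallization.Theorems.ChargedEnergyGapNegative (E3)
open Summit.AtomisticToContinuum.Crystallization.Theorems.FrustratedLawDichotomyCoherentSets (coherentAt)
open Summit.AtomisticToContinuum.Crystallization.Theorems.FrustratedLawDichotomyCoherentFloorAlgebra
open Summit.AtomisticToContinuum.Crystallization.Theorems.FrustratedLawDichotomyCoherentFloor
open Summit.AtomisticToContinuum.Crystallization.Theorems.FrustratedLawDichotomyCellFrame
open Summit.AtomisticToContinuum.Crystallization.Theorems.FrustratedLawDichotomyCellMetric

variable {ι : Type*} [DecidableEq ι]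

/-! ## §1. Two-corner sums and the admissibility clauses over a metric box -/

/-- Lower two-corner sum of the Gram value `gram G v w` over the entrywise box `Glo ≤ G ≤ Ghi` (label data `v, w` known). -/
def gramLo (Glo Ghi : Matrix (Fin 3) (Fin 3) ℝ) (v w : Fin 3 → ℝ) : ℝ := ∑ i, ∑ j, min (Glo i j * (v i * w j)) (Ghi i j * (v i * w j))

/-- Upper two-corner sum of the Gram value `gram G v w` over the entrywise box `Glo ≤ G ≤ Ghi`. -/
def gramHi (Glo Ghi : Matrix (Fin 3) (Fin 3) ℝ) (v w : Fin 3 → ℝ) : ℝ := ∑ i, ∑ j, max (Glo i j * (v i * w j)) (Ghi i j * (v i * w j))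

section Box

variable {Glo Ghi : Matrix (Fin 3) (Fin 3) ℝ} {F : Matrix (Fin 3) (Fin 3) ℝ}

omit [DecidableEq ι] in
/-- [folklore] -/
theorem gramLo_le (hlo : ∀ i j, Glo i j ≤ (F.transpose * F) i j) (hhi : ∀ i j, (F.transpose * F) i j ≤ Ghi i j) (v w : Fin 3 → ℝ) :
    gramLo Glo Ghi v w ≤ gram (F.transpose * F) v w :=
  (gram_mem_box hlo hhi v w).1

omit [DecidableEq ι] in
/-- [folklore] -/
theorem le_gramHi (hlo : ∀ i j, Glo i j ≤ (F.transpose * F) i j) (hhi : ∀ i j, (F.transpose * F) i j ≤ Ghi i j) (v w : Fin 3 → ℝ) :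
    gram (F.transpose * F) v w ≤ gramHi Glo Ghi v w :=
  (gram_mem_box hlo hhi v w).2

omit [DecidableEq ι] in
/-- strict sqrt-free lower norm window: `b² < gram v v` ⇒ `b < ‖posL F v‖` (any sign of `b`). [folklore] -/
theorem lt_norm_posL {v : Fin 3 → ℝ} {b : ℝ} (h : b ^ 2 < gram (F.transpose * F) v v) : b < ‖posL F v‖ := by
  rw [← norm_sq_posL] at h
  exact lt_of_pow_lt_pow_left₀ 2 (norm_nonneg _) h

omit [DecidableEq ι] in
/-- SEPARATION over the box: `c² < gramLo (v − w) (v − w)` ⇒ `c < dist (posL F v) (posL F w)` for every `F` in the box. [folklore] -/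
theorem sep_of_gramLo (hlo : ∀ i j, Glo i j ≤ (F.transpose * F) i j) (hhi : ∀ i j, (F.transpose * F) i j ≤ Ghi i j) {v w : Fin 3 → ℝ}
    {c : ℝ} (h : c ^ 2 < gramLo Glo Ghi (v - w) (v - w)) : c < dist (posL F v) (posL F w) := by
  rw [dist_posL]
  exact lt_norm_posL (h.trans_le (gramLo_le hlo hhi _ _))

omit [DecidableEq ι] in
/-- WINDOW over the box: `gramHi v v ≤ (R − τ)²`, `0 ≤ R − τ` ⇒ `‖posL F v‖ + τ ≤ R`. [folklore] -/
theorem norm_add_le_of_gramHi (hlo : ∀ i j, Glo i j ≤ (F.transpose * F) i j) (hhi : ∀ i j, (F.transpose * F) i j ≤ Ghi i j)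
    {v : Fin 3 → ℝ} {R τ : ℝ} (hR : 0 ≤ R - τ) (h : gramHi Glo Ghi v v ≤ (R - τ) ^ 2) : ‖posL F v‖ + τ ≤ R := by
  have h1 := norm_posL_le (F := F) hR ((le_gramHi hlo hhi v v).trans h)
  linarith

omit [DecidableEq ι] in
/-- INTERIOR INSET over the box: `gramHi v v ≤ (R − τ − d)²`, `0 ≤ R − τ − d` ⇒ `d ≤ R − (‖posL F v‖ + τ)`. [folklore] -/
theorem inset_of_gramHi (hlo : ∀ i j, Glo i j ≤ (F.transpose * F) i j) (hhi : ∀ i j, (F.transpose * F) i j ≤ Ghi i j)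
    {v : Fin 3 → ℝ} {R τ d : ℝ} (hR : 0 ≤ R - τ - d) (h : gramHi Glo Ghi v v ≤ (R - τ - d) ^ 2) : d ≤ R - (‖posL F v‖ + τ) := by
  have h1 := norm_posL_le (F := F) hR ((le_gramHi hlo hhi v v).trans h)
  linarith

omit [DecidableEq ι] in
/-- non-strict sqrt-free lower norm window without sign condition: `b² ≤ gram v v` ⇒ `b ≤ ‖posL F v‖`. [folklore] -/
theorem le_norm_posL' {v : Fin 3 → ℝ} {b : ℝ} (h : b ^ 2 ≤ gram (F.transpose * F) v v) : b ≤ ‖posL F v‖ := by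
  rw [← norm_sq_posL] at h
  exact le_of_pow_le_pow_left₀ two_ne_zero (norm_nonneg _) h

omit [DecidableEq ι] in
/-- LOWER DISTANCE over the box: `c² ≤ gramLo (v − w) (v − w)` ⇒ `c ≤ dist (posL F v) (posL F w)` — discharges the list side conditions
`x ∉ nb z → L ≤ dist …` and the `δ`-separation of `…CellTailsRem.lb_le_certFloorL_trunc` uniformly over the box. [folklore] -/
theorem le_dist_of_gramLo (hlo : ∀ i j, Glo i j ≤ (F.transpose * F) i j) (hhi : ∀ i j, (F.transpose * F) i j ≤ Ghi i j)
    {v w : Fin 3 → ℝ} {c : ℝ} (h : c ^ 2 ≤ gramLo Glo Ghi (v - w) (v - w)) : c ≤ dist (posL F v) (posL F w) := by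
  rw [dist_posL]
  exact le_norm_posL' (h.trans (gramLo_le hlo hhi _ _))

omit [DecidableEq ι] in
/-- LOWER NORM over the box: `c² ≤ gramLo v v` ⇒ `c ≤ ‖posL F v‖` — discharges `m ∉ MN → R_N ≤ ‖pos m‖`, `m ∉ ML → L_D ≤ ‖pos m‖`. [folklore] -/
theorem le_norm_of_gramLo (hlo : ∀ i j, Glo i j ≤ (F.transpose * F) i j) (hhi : ∀ i j, (F.transpose * F) i j ≤ Ghi i j)
    {v : Fin 3 → ℝ} {c : ℝ} (h : c ^ 2 ≤ gramLo Glo Ghi v v) : c ≤ ‖posL F v‖ :=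
  le_norm_posL' (h.trans (gramLo_le hlo hhi _ _))

omit [DecidableEq ι] in
/-- UPPER NORM over the box: `gramHi v v ≤ b²`, `0 ≤ b` ⇒ `‖posL F v‖ ≤ b` — host distances, far-column arguments `Rc − (‖pos m‖ + τ)`
(with `farCol_anti`), mirror facts. [folklore] -/
theorem norm_le_of_gramHi (hlo : ∀ i j, Glo i j ≤ (F.transpose * F) i j) (hhi : ∀ i j, (F.transpose * F) i j ≤ Ghi i j)
    {v : Fin 3 → ℝ} {b : ℝ} (hb : 0 ≤ b) (h : gramHi Glo Ghi v v ≤ b ^ 2) : ‖posL F v‖ ≤ b :=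
  norm_posL_le (F := F) hb ((le_gramHi hlo hhi v v).trans h)

omit [DecidableEq ι] in
/-- SQUARED-NORM WINDOW over the box (sqrt-free, the `t = r²` windows of (238) `psiT_mem` / `secondNeg_le` and (229) `shellMin_le_phiT`):
`gramLo v v ≤ ‖posL F v‖² ≤ gramHi v v`. [folklore] -/
theorem norm_sq_mem_of_box (hlo : ∀ i j, Glo i j ≤ (F.transpose * F) i j) (hhi : ∀ i j, (F.transpose * F) i j ≤ Ghi i j)
    (v : Fin 3 → ℝ) : gramLo Glo Ghi v v ≤ ‖posL F v‖ ^ 2 ∧ ‖posL F v‖ ^ 2 ≤ gramHi Glo Ghi v v := by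
  rw [norm_sq_posL]
  exact ⟨gramLo_le hlo hhi v v, le_gramHi hlo hhi v v⟩

omit [DecidableEq ι] in
/-- SQUARED-DISTANCE WINDOW over the box: `gramLo (v − w) (v − w) ≤ dist² ≤ gramHi (v − w) (v − w)`. [folklore] -/
theorem dist_sq_mem_of_box (hlo : ∀ i j, Glo i j ≤ (F.transpose * F) i j) (hhi : ∀ i j, (F.transpose * F) i j ≤ Ghi i j)
    (v w : Fin 3 → ℝ) :
    gramLo Glo Ghi (v - w) (v - w) ≤ dist (posL F v) (posL F w) ^ 2 ∧ dist (posL F v) (posL F w) ^ 2 ≤ gramHi Glo Ghi (v - w) (v - w) := by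
  rw [dist_posL]
  exact norm_sq_mem_of_box hlo hhi _

end Box

/-! ## §2. ★ The class-A row floor over a metric box from corner inequalities -/

/-- ★★ **ROW FLOOR OF A METRIC-BOX CELL.**  Template label data `a : ι → Fin 3 → ℝ` with `a o = 0`, a parameter set `B` of cell matrices inside
the metric box `Glo ≤ FᵀF ≤ Ghi`, placements `posL F (a m)` and any multipliers `YF F`.  If the RATIONAL corner facts hold — `(2τ)² < gramLo
(a m − a m') (a m − a m')` for distinct template labels, `gramHi (a m) (a m) ≤ (Rc − τ)²` on the template, `gramHi (a m) (a m) ≤ (Rc − τ − 7/20)²`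
on the interior — and every placement is CERTIFIED (`2(cUp + mc) ≤ certFloorL`, `c ≤ cUp`), then on the row
`⋃_{F ∈ B} coherentAt (M.image (posL F ∘ a)) τ Rc` every rooted `7/10`-hard-core Nash configuration has `c + mc ≤ rootEnergy`:
`…CellFrame.rowFloor_of_cells` with its admissibility clauses discharged uniformly over the box. [folklore] -/
theorem rowFloor_of_gramBox (Glo Ghi : Matrix (Fin 3) (Fin 3) ℝ) (B : Set (Matrix (Fin 3) (Fin 3) ℝ))
    (hB : ∀ F ∈ B, (∀ i j, Glo i j ≤ (F.transpose * F) i j) ∧ ∀ i j, (F.transpose * F) i j ≤ Ghi i j)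
    (M MI : Finset ι) (o : ι) (a : ι → Fin 3 → ℝ) (YF : Matrix (Fin 3) (Fin 3) ℝ → ι → E3) {τ Rc c mc : ℝ}
    (hτ0 : 0 ≤ τ) (hτ : 2 * τ < 7 / 10) (hRc : 1 ≤ Rc) (ho : o ∈ M) (hMI : MI ⊆ M) (ha0 : a o = 0)
    (hsep : ∀ m ∈ M, ∀ m' ∈ M, m ≠ m' → (2 * τ) ^ 2 < gramLo Glo Ghi (a m - a m') (a m - a m'))
    (hRcτ : 0 ≤ Rc - τ) (hin : ∀ m ∈ M, gramHi Glo Ghi (a m) (a m) ≤ (Rc - τ) ^ 2)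
    (hRcI : 0 ≤ Rc - τ - 7 / 20) (hI : ∀ m ∈ MI, gramHi Glo Ghi (a m) (a m) ≤ (Rc - τ - 7 / 20) ^ 2)
    {cUp : ℝ} (hc : c ≤ cUp) (hcert : ∀ F ∈ B, 2 * (cUp + mc) ≤ certFloorL M MI o (fun m => posL F (a m)) (YF F) τ Rc)
    (μ : Measure E3) (hμ : IsRootedHardCore (7 / 10) μ)
    (hNash : ∀ p : E3, μ {p} ≠ 0 → ∀ w : E3, (∀ q : E3, μ {q} ≠ 0 → q ≠ p → w ≠ q) →
      ∑' q : {q : E3 // μ {q} ≠ 0 ∧ q ≠ p}, lennardJones (dist p (q : E3)) ≤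
        ∑' q : {q : E3 // μ {q} ≠ 0 ∧ q ≠ p}, lennardJones (dist w (q : E3)))
    (hrow : μ ∈ ⋃ F ∈ B, coherentAt (M.image fun m => posL F (a m)) τ Rc) :
    c + mc ≤ rootEnergy lennardJones μ := by
  refine rowFloor_of_cells B M MI o (fun F m => posL F (a m)) YF hτ0 hτ hRc ho hMI ?_ ?_ ?_ ?_ hc hcert μ hμ hNash hrow
  · intro F _
    show posL F (a o) = 0
    rw [ha0, posL_zero]
  · intro F hF m hm m' hm' hne
    exact sep_of_gramLo (hB F hF).1 (hB F hF).2 (hsep m hm m' hm' hne)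
  · intro F hF m hm
    exact norm_add_le_of_gramHi (hB F hF).1 (hB F hF).2 hRcτ (hin m hm)
  · intro F hF m hm
    exact inset_of_gramHi (hB F hF).1 (hB F hF).2 hRcI (hI m hm)

end Summit.AtomisticToContinuum.Crystallization.Theorems.FrustratedLawDichotomyCellAdmissible

end
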